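import Literature.MathematicalPhysics.KineticTheory.HardSphereCampbellAssembly
import Literature.Analysis.FluidPDE.SphereMeasureSymmetry
import Literature.Analysis.FluidPDE.HardSphereTorusMeasure
import HarnessLib

/-!
# Statics of the one-pair outgoing collision flux of hard spheres on the torus

Topic `Literature/MathematicalPhysics/KineticTheory`. Two static (measure-theoretic, no dynamics)
properties of the one-pair term
`Flux_{ab}(K) = ∫ dz ∫_{S^{d-1}} dω ε^{d-1} (⟪ω, v_a − v_b⟫)₊ (1_{D_ε} K)(z^{ab}_ω)`,
`z^{ab}_ω = contactInsert ε a b ω z` (particle `a` placed at contact with `b` in direction `ω`), of the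
outgoing collision flux `outgoingCollisionFlux` of `HardSphereCollisionCampbell` — both inputs of the
discharge of the named fact `HardSphereCampbellFormula` (the stationary collision-rate / special-flow
identity of Cercignani–Illner–Pulvirenti 1994, App. 4.A pp. 107–111, where the Lebesgue measure of the
phase space is read as `dσ dt` over the contact hypersurface `Σ = ⋃ Σ_{ab}`):

* `pairFlux_swap` — **`Flux_{ab}(K) = Flux_{ba}(K)`**: the contact hypersurface `Σ_{ab} = Σ_{ba}` with
  its measure `dσ = ∏_{k ≠ a} dx_k ∏_k dξ_k dγ_{ab} |n_{ab}·(ξ_a − ξ_b)|` (CIP 1994 p. 111) may be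
  parametrised from either particle of the pair. Proof: the map `(z, ω) ↦ (z', −ω)`, `z'` being `z`
  with the positions of `a, b` replaced by `(x_b + εω, x_a)`, carries the `(b, a)`-integrand to the
  `(a, b)`-integrand; for fixed `ω` the map `z ↦ z'` (exchange of two position coordinates followed by
  a translation of one of them) preserves the Liouville measure, and `ω ↦ −ω` preserves the surface
  measure of the sphere (`Literature.Analysis.FluidPDE.measurePreserving_neg_sphere`); Tonelli.
* `pairFlux_shell_lt_top` — **the flux of an energy-shell mark `c · 1{E ≤ E₀}` is finite**: on the
  shell the speeds are at most `√(2E₀)`, so the integrand is bounded by a constant times the indicator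
  of the shell, whose Liouville volume is at most `vol(B̄(0, √(2E₀)))^N`
  (`Literature.Analysis.FluidPDE.volume_velBall`), and the surface measure of the sphere is finite.

## References

* [CIP1994] C. Cercignani, R. Illner, M. Pulvirenti, *The Mathematical Theory of Dilute Gases*,
  Applied Math. Sciences 106, Springer (1994), App. 4.A pp. 107–111 (special flow representation,
  the measure `dσ` on `Σᵢⱼ`, p. 111).
-/

open MeasureTheory Set Function Filter Metric
open scoped ENNReal NNReal RealInnerProductSpace

namespace Literature.MathematicalPhysics.KineticTheory

open Literature.Analysis.FluidPDE

noncomputable section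

variable {d : Type*} [Fintype d] {N : ℕ} {ε : ℝ}

/-! ### Tools: a volume-preserving relabelling of two positions, measurability -/

/-- Exchanging the positions of the particles `a, b` (velocities kept) and translating the new
position of `a` by `c` preserves the Liouville measure `volume` on `(T^d × ℝ^d)^N` (positions and
velocities are independent product coordinates; relabelling and translations preserve Haar
measure). [folklore] -/
theorem campbell_measurePreserving_swapPos (a b : Fin N) (c : UnitAddTorus d) :
    MeasurePreserving (fun z : Config N d (UnitAddTorus d) => fun k =>
      ((z (Equiv.swap a b k)).1 + (Pi.single a c : Fin N → UnitAddTorus d) k, (z k).2))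
      volume volume := by
  set e := MeasurableEquiv.arrowProdEquivProdArrow (UnitAddTorus d) (EuclideanSpace ℝ d) (Fin N)
  have he : MeasurePreserving e volume volume :=
    volume_measurePreserving_arrowProdEquivProdArrow (UnitAddTorus d) (EuclideanSpace ℝ d) (Fin N)
  have hswap : MeasurePreserving (fun X : Fin N → UnitAddTorus d => X ∘ Equiv.swap a b)
      volume volume := by
    have h := volume_measurePreserving_piCongrLeft (fun _ : Fin N => UnitAddTorus d) (Equiv.swap a b)
    have hcoe : ⇑(MeasurableEquiv.piCongrLeft (fun _ : Fin N => UnitAddTorus d) (Equiv.swap a b)) =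
        fun X : Fin N → UnitAddTorus d => X ∘ Equiv.swap a b := by
      funext X i
      simp [MeasurableEquiv.coe_piCongrLeft, Equiv.piCongrLeft_apply_eq_cast]
    rwa [hcoe] at h
  haveI : Measure.IsAddRightInvariant (volume : Measure (Fin N → UnitAddTorus d)) :=
    Measure.pi.isAddRightInvariant _
  have hadd : MeasurePreserving (fun X : Fin N → UnitAddTorus d => X + Pi.single a c) volume volume :=
    measurePreserving_add_right (G := Fin N → UnitAddTorus d) volume (Pi.single a c)
  have hprod := (hadd.comp hswap).prod
    (MeasurePreserving.id (volume : Measure (Fin N → EuclideanSpace ℝ d)))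
  have htot := ((MeasurePreserving.symm e he).comp hprod).comp he
  have hfun : (fun z : Config N d (UnitAddTorus d) => fun k =>
      ((z (Equiv.swap a b k)).1 + (Pi.single a c : Fin N → UnitAddTorus d) k, (z k).2)) =
      e.symm ∘ (Prod.map ((fun X : Fin N → UnitAddTorus d => X + Pi.single a c) ∘
        (fun X : Fin N → UnitAddTorus d => X ∘ Equiv.swap a b)) id) ∘ e := by
    funext z k
    rfl
  rw [hfun]
  exact htot

omit [Fintype d] in
/-- In the relabelled configuration of `campbell_measurePreserving_swapPos` (shift `εω`), placing
`b` at contact with `a` in the direction `-ω` gives back `z` with `a` placed at contact with `b` in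
the direction `ω`: the same point of the contact hypersurface `Σ_{ab} = Σ_{ba}`. [folklore] -/
theorem campbell_contactInsert_swapPos [Fintype d] (ε : ℝ) {a b : Fin N} (hab : a ≠ b)
    (ω : EuclideanSpace ℝ d) (z : Config N d (UnitAddTorus d)) :
    contactInsert ε b a (-ω) (fun k => ((z (Equiv.swap a b k)).1 +
        (Pi.single a (Literature.Analysis.FunctionSpaces.Torus.proj (ε • ω)) :
          Fin N → UnitAddTorus d) k, (z k).2)) =
      contactInsert ε a b ω z := by
  funext k
  by_cases hkb : k = b
  · rw [hkb, contactInsert_apply_self, contactInsert_apply_of_ne ε b ω z hab.symm]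
    simp [smul_neg]
  · by_cases hka : k = a
    · rw [hka, contactInsert_apply_self, contactInsert_apply_of_ne ε a (-ω) _ hab]
      simp
    · rw [contactInsert_apply_of_ne ε a (-ω) _ hkb, contactInsert_apply_of_ne ε b ω z hka]
      simp [Equiv.swap_apply_of_ne_of_ne hka hkb, hka]

/-- Joint measurability in (configuration, direction) of the flux integrand with weight read on the
pair `(a', b')`, mark `K` and insertion of `i` at contact with `j` in the direction `φ(ω)` for a
measurable `φ` (identity or antipodal map). [folklore] -/
theorem campbell_measurable_fluxIntegrand_comp (ε : ℝ) {K : Config N d (UnitAddTorus d) → ℝ≥0∞}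
    (hK : Measurable K) (i j a' b' : Fin N) {φ : EuclideanSpace ℝ d → EuclideanSpace ℝ d}
    (hφ : Measurable φ) :
    Measurable fun p : Config N d (UnitAddTorus d) × Metric.sphere (0 : EuclideanSpace ℝ d) 1 =>
      ENNReal.ofReal (ε ^ (Fintype.card d - 1) * ⟪((p.2 : EuclideanSpace ℝ d)), (p.1 a').2 - (p.1 b').2⟫) *
        (hardSphereDomain (Torus.geometry d) N ε).indicator K
          (contactInsert ε i j (φ (p.2 : EuclideanSpace ℝ d)) p.1) := by
  have hω : Measurable fun p : Config N d (UnitAddTorus d) × Metric.sphere (0 : EuclideanSpace ℝ d) 1 =>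
      (p.2 : EuclideanSpace ℝ d) := measurable_subtype_coe.comp measurable_snd
  have hv : ∀ k : Fin N, Measurable fun p : Config N d (UnitAddTorus d) ×
      Metric.sphere (0 : EuclideanSpace ℝ d) 1 => (p.1 k).2 :=
    fun k => measurable_snd.comp ((measurable_pi_apply k).comp measurable_fst)
  have h1 : Measurable fun p : Config N d (UnitAddTorus d) × Metric.sphere (0 : EuclideanSpace ℝ d) 1 =>
      ε ^ (Fintype.card d - 1) * ⟪((p.2 : EuclideanSpace ℝ d)), (p.1 a').2 - (p.1 b').2⟫ :=
    measurable_const.mul (hω.inner ((hv a').sub (hv b')))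
  have hD : MeasurableSet (hardSphereDomain (Torus.geometry d) N ε) :=
    measurableSet_hardSphereDomain _ Torus.measurable_geometry_sepVec N ε
  have hci : Measurable fun p : Config N d (UnitAddTorus d) × Metric.sphere (0 : EuclideanSpace ℝ d) 1 =>
      contactInsert ε i j (φ (p.2 : EuclideanSpace ℝ d)) p.1 := by
    unfold contactInsert
    have hx : Measurable fun p : Config N d (UnitAddTorus d) × Metric.sphere (0 : EuclideanSpace ℝ d) 1 =>
        ((p.1 j).1 + Literature.Analysis.FunctionSpaces.Torus.proj (ε • φ (p.2 : EuclideanSpace ℝ d)),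
          (p.1 i).2) :=
      ((measurable_fst.comp ((measurable_pi_apply j).comp measurable_fst)).add
        ((Literature.Analysis.FunctionSpaces.Torus.measurable_proj (d := d)).comp
          ((measurable_const_smul ε).comp (hφ.comp hω)))).prodMk (hv i)
    exact measurable_update'.comp (measurable_fst.prodMk hx)
  exact h1.ennreal_ofReal.mul ((hK.indicator hD).comp hci)

/-- Measurability in the configuration of the flux integrand with weight read on the pair
`(a', b')` in the direction `u`, mark `K` and insertion of `i` at contact with `j` in the direction `v`.
[folklore] -/
theorem campbell_measurable_fluxSlice (ε : ℝ) {K : Config N d (UnitAddTorus d) → ℝ≥0∞}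
    (hK : Measurable K) (i j a' b' : Fin N) (u v : EuclideanSpace ℝ d) :
    Measurable fun z : Config N d (UnitAddTorus d) =>
      ENNReal.ofReal (ε ^ (Fintype.card d - 1) * ⟪u, (z a').2 - (z b').2⟫) *
        (hardSphereDomain (Torus.geometry d) N ε).indicator K (contactInsert ε i j v z) := by
  have hv : ∀ k : Fin N, Measurable fun z : Config N d (UnitAddTorus d) => (z k).2 :=
    fun k => measurable_snd.comp (measurable_pi_apply k)
  have h1 : Measurable fun z : Config N d (UnitAddTorus d) =>
      ε ^ (Fintype.card d - 1) * ⟪u, (z a').2 - (z b').2⟫ :=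
    measurable_const.mul (measurable_const.inner ((hv a').sub (hv b')))
  have hD : MeasurableSet (hardSphereDomain (Torus.geometry d) N ε) :=
    measurableSet_hardSphereDomain _ Torus.measurable_geometry_sepVec N ε
  have hci : Measurable fun z : Config N d (UnitAddTorus d) => contactInsert ε i j v z := by
    unfold contactInsert
    have hx : Measurable fun z : Config N d (UnitAddTorus d) =>
        ((z j).1 + Literature.Analysis.FunctionSpaces.Torus.proj (ε • v), (z i).2) :=
      ((measurable_fst.comp (measurable_pi_apply j)).add_const _).prodMk (hv i)
    exact measurable_update'.comp (measurable_id.prodMk hx)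
  exact h1.ennreal_ofReal.mul ((hK.indicator hD).comp hci)

/-! ### Symmetry of the pair flux under exchange of the pair -/

/-- **The one-pair outgoing flux is symmetric in the pair**: `Flux_{ab}(K) = Flux_{ba}(K)` for every
measurable mark `K ≥ 0` — the contact hypersurface `Σ_{ab} = Σ_{ba}` with CIP's measure
`dσ = ∏_{k≠a} dx_k ∏_k dξ_k dγ_{ab} |n_{ab}·(ξ_a − ξ_b)|` parametrised from either particle: the change
of variables `(z, ω) ↦ (z', −ω)` (positions of `a, b` replaced by `(x_b + εω, x_a)`), measure
preserving by `campbell_measurePreserving_swapPos` and the antipodal symmetry of the sphere, carries one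
integrand to the other (`campbell_contactInsert_swapPos`). [cite: CIP1994, App. 4.A pp. 107–111] -/
theorem pairFlux_swap (hε0 : 0 ≤ ε) (hε : ε < 1 / 2) {a b : Fin N} (hab : a ≠ b)
    {K : Config N d (UnitAddTorus d) → ℝ≥0∞} (hK : Measurable K) :
    ∫⁻ z : Config N d (UnitAddTorus d), ∫⁻ ω : Metric.sphere (0 : EuclideanSpace ℝ d) 1,
        ENNReal.ofReal (ε ^ (Fintype.card d - 1) * ⟪((ω : EuclideanSpace ℝ d)), (z a).2 - (z b).2⟫) *
          (hardSphereDomain (Torus.geometry d) N ε).indicator K (contactInsert ε a b (ω : EuclideanSpace ℝ d) z)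
        ∂(volume : Measure (EuclideanSpace ℝ d)).toSphere =
      ∫⁻ z : Config N d (UnitAddTorus d), ∫⁻ ω : Metric.sphere (0 : EuclideanSpace ℝ d) 1,
        ENNReal.ofReal (ε ^ (Fintype.card d - 1) * ⟪((ω : EuclideanSpace ℝ d)), (z b).2 - (z a).2⟫) *
          (hardSphereDomain (Torus.geometry d) N ε).indicator K (contactInsert ε b a (ω : EuclideanSpace ℝ d) z)
        ∂(volume : Measure (EuclideanSpace ℝ d)).toSphere := by
  have _ : (0 : ℝ) < 1 / 2 := hε0.trans_lt hε
  haveI hXE : SigmaFinite (volume : Measure (UnitAddTorus d × EuclideanSpace ℝ d)) := inferInstance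
  haveI hC : SigmaFinite (volume : Measure (Config N d (UnitAddTorus d))) := inferInstance
  -- the antipodal map preserves the surface measure
  have hneg : MeasurePreserving (fun ω : Metric.sphere (0 : EuclideanSpace ℝ d) 1 => -ω)
      (volume : Measure (EuclideanSpace ℝ d)).toSphere (volume : Measure (EuclideanSpace ℝ d)).toSphere :=
    measurePreserving_neg_sphere (E := EuclideanSpace ℝ d)
  have hemb := (Homeomorph.neg (Metric.sphere (0 : EuclideanSpace ℝ d) 1)).measurableEmbedding
  -- Step 1: `ω ↦ -ω` in the inner integral of the right-hand side
  have step1 : ∀ z : Config N d (UnitAddTorus d),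
      ∫⁻ ω : Metric.sphere (0 : EuclideanSpace ℝ d) 1,
        ENNReal.ofReal (ε ^ (Fintype.card d - 1) * ⟪((ω : EuclideanSpace ℝ d)), (z b).2 - (z a).2⟫) *
          (hardSphereDomain (Torus.geometry d) N ε).indicator K
            (contactInsert ε b a (ω : EuclideanSpace ℝ d) z)
        ∂(volume : Measure (EuclideanSpace ℝ d)).toSphere =
      ∫⁻ ω : Metric.sphere (0 : EuclideanSpace ℝ d) 1,
        ENNReal.ofReal (ε ^ (Fintype.card d - 1) * ⟪((ω : EuclideanSpace ℝ d)), (z a).2 - (z b).2⟫) *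
          (hardSphereDomain (Torus.geometry d) N ε).indicator K
            (contactInsert ε b a (-(ω : EuclideanSpace ℝ d)) z)
        ∂(volume : Measure (EuclideanSpace ℝ d)).toSphere := by
    intro z
    rw [← hneg.lintegral_comp_emb hemb]
    refine lintegral_congr fun ω => ?_
    rw [coe_neg_sphere, inner_neg_left, ← inner_neg_right, neg_sub]
  -- Step 2: for a fixed direction, the volume-preserving relabelling of the two positions
  have step2 : ∀ ω : Metric.sphere (0 : EuclideanSpace ℝ d) 1,
      ∫⁻ z : Config N d (UnitAddTorus d),
        ENNReal.ofReal (ε ^ (Fintype.card d - 1) * ⟪((ω : EuclideanSpace ℝ d)), (z a).2 - (z b).2⟫) *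
          (hardSphereDomain (Torus.geometry d) N ε).indicator K
            (contactInsert ε a b (ω : EuclideanSpace ℝ d) z) =
      ∫⁻ z : Config N d (UnitAddTorus d),
        ENNReal.ofReal (ε ^ (Fintype.card d - 1) * ⟪((ω : EuclideanSpace ℝ d)), (z a).2 - (z b).2⟫) *
          (hardSphereDomain (Torus.geometry d) N ε).indicator K
            (contactInsert ε b a (-(ω : EuclideanSpace ℝ d)) z) := by
    intro ω
    have hT := campbell_measurePreserving_swapPos (N := N) a b
      (Literature.Analysis.FunctionSpaces.Torus.proj (ε • (ω : EuclideanSpace ℝ d)))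
    have hmeas : Measurable fun z : Config N d (UnitAddTorus d) =>
        ENNReal.ofReal (ε ^ (Fintype.card d - 1) * ⟪((ω : EuclideanSpace ℝ d)), (z a).2 - (z b).2⟫) *
          (hardSphereDomain (Torus.geometry d) N ε).indicator K
            (contactInsert ε b a (-(ω : EuclideanSpace ℝ d)) z) :=
      campbell_measurable_fluxSlice ε hK b a a b _ _
    rw [← hT.lintegral_comp hmeas]
    refine lintegral_congr fun z => ?_
    rw [campbell_contactInsert_swapPos ε hab]
  -- Tonelli on both sides
  have hFae : AEMeasurable (uncurry fun (z : Config N d (UnitAddTorus d))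
      (ω : Metric.sphere (0 : EuclideanSpace ℝ d) 1) =>
        ENNReal.ofReal (ε ^ (Fintype.card d - 1) * ⟪((ω : EuclideanSpace ℝ d)), (z a).2 - (z b).2⟫) *
          (hardSphereDomain (Torus.geometry d) N ε).indicator K
            (contactInsert ε a b (ω : EuclideanSpace ℝ d) z))
      ((volume : Measure (Config N d (UnitAddTorus d))).prod
        (volume : Measure (EuclideanSpace ℝ d)).toSphere) :=
    (campbell_measurable_fluxIntegrand_comp ε hK a b a b measurable_id).aemeasurable
  have hGae : AEMeasurable (uncurry fun (z : Config N d (UnitAddTorus d))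
      (ω : Metric.sphere (0 : EuclideanSpace ℝ d) 1) =>
        ENNReal.ofReal (ε ^ (Fintype.card d - 1) * ⟪((ω : EuclideanSpace ℝ d)), (z a).2 - (z b).2⟫) *
          (hardSphereDomain (Torus.geometry d) N ε).indicator K
            (contactInsert ε b a (-(ω : EuclideanSpace ℝ d)) z))
      ((volume : Measure (Config N d (UnitAddTorus d))).prod
        (volume : Measure (EuclideanSpace ℝ d)).toSphere) :=
    (campbell_measurable_fluxIntegrand_comp ε hK b a a b measurable_neg).aemeasurable
  rw [lintegral_lintegral_swap hFae, lintegral_congr step2, ← lintegral_lintegral_swap hGae]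
  exact lintegral_congr fun z => (step1 z).symm

/-! ### Finiteness of the pair flux of an energy shell -/

/-- **The one-pair outgoing flux of an energy-shell mark is finite**:
`Flux_{ab}(c · 1{E ≤ E₀}) < ∞`. The insertion keeps the velocities, so the mark is read on the shell
`E(z) ≤ E₀`, where `‖v_a‖, ‖v_b‖ ≤ √(2E₀)` bound the weight `ε^{d-1}⟪ω, v_a − v_b⟫` by a constant; the
shell has Liouville volume at most `vol(B̄(0, √(2E₀)))^N` (Haar measure on `T^d` is a probability) and
the surface measure of the sphere is finite (CIP work on compact energy shells, where both sides of the
special-flow identity are finite). [cite: CIP1994, App. 4.A pp. 107–111] -/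
theorem pairFlux_shell_lt_top (ε : ℝ) (a b : Fin N) (E₀ : ℝ) (c : ℝ≥0) :
    ∫⁻ z : Config N d (UnitAddTorus d), ∫⁻ ω : Metric.sphere (0 : EuclideanSpace ℝ d) 1,
        ENNReal.ofReal (ε ^ (Fintype.card d - 1) * ⟪((ω : EuclideanSpace ℝ d)), (z a).2 - (z b).2⟫) *
          (hardSphereDomain (Torus.geometry d) N ε).indicator
            (fun w => if configEnergy w ≤ E₀ then (c : ℝ≥0∞) else 0)
            (contactInsert ε a b (ω : EuclideanSpace ℝ d) z)
        ∂(volume : Measure (EuclideanSpace ℝ d)).toSphere < ⊤ := by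
  haveI hXE : SigmaFinite (volume : Measure (UnitAddTorus d × EuclideanSpace ℝ d)) := inferInstance
  haveI hC : SigmaFinite (volume : Measure (Config N d (UnitAddTorus d))) := inferInstance
  -- the shell, the speed bound and the constant
  set V : ℝ := Real.sqrt (2 * E₀) with hV
  have hV0 : 0 ≤ V := Real.sqrt_nonneg _
  have hE₀V : E₀ ≤ V ^ 2 / 2 := by
    rcases le_or_gt 0 E₀ with h | h
    · rw [hV, Real.sq_sqrt (by linarith)]
      linarith
    · have := sq_nonneg V
      linarith
  set S : Set (Config N d (UnitAddTorus d)) := {z | configEnergy z ≤ E₀}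
  have hSm : MeasurableSet S := measurableSet_le measurable_configEnergy_torus measurable_const
  set W : ℝ≥0∞ := ENNReal.ofReal (|ε| ^ (Fintype.card d - 1) * (V + V))
  -- pointwise bound of the integrand by a constant times the indicator of the shell
  have hpt : ∀ (z : Config N d (UnitAddTorus d)) (ω : Metric.sphere (0 : EuclideanSpace ℝ d) 1),
      ENNReal.ofReal (ε ^ (Fintype.card d - 1) * ⟪((ω : EuclideanSpace ℝ d)), (z a).2 - (z b).2⟫) *
          (hardSphereDomain (Torus.geometry d) N ε).indicator
            (fun w => if configEnergy w ≤ E₀ then (c : ℝ≥0∞) else 0)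
            (contactInsert ε a b (ω : EuclideanSpace ℝ d) z) ≤
        S.indicator (fun _ => W * c) z := by
    intro z ω
    have hE : configEnergy (contactInsert ε a b (ω : EuclideanSpace ℝ d) z) = configEnergy z := by
      simp [configEnergy]
    by_cases hz : configEnergy z ≤ E₀
    · rw [indicator_of_mem (show z ∈ S from hz)]
      refine mul_le_mul' (ENNReal.ofReal_le_ofReal ?_) ?_
      · have hzV : configEnergy z ≤ V ^ 2 / 2 := hz.trans hE₀V
        have ha := norm_vel_le_of_configEnergy_le hV0 hzV a
        have hb := norm_vel_le_of_configEnergy_le hV0 hzV b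
        have hω : ‖(ω : EuclideanSpace ℝ d)‖ = 1 := norm_eq_of_mem_sphere ω
        have hpow : 0 ≤ |ε| ^ (Fintype.card d - 1) := pow_nonneg (abs_nonneg _) _
        calc ε ^ (Fintype.card d - 1) * ⟪((ω : EuclideanSpace ℝ d)), (z a).2 - (z b).2⟫
            ≤ |ε ^ (Fintype.card d - 1) * ⟪((ω : EuclideanSpace ℝ d)), (z a).2 - (z b).2⟫| :=
              le_abs_self _
          _ = |ε| ^ (Fintype.card d - 1) * |⟪((ω : EuclideanSpace ℝ d)), (z a).2 - (z b).2⟫| := by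
              rw [abs_mul, abs_pow]
          _ ≤ |ε| ^ (Fintype.card d - 1) * (‖(ω : EuclideanSpace ℝ d)‖ * ‖(z a).2 - (z b).2‖) :=
              mul_le_mul_of_nonneg_left (abs_real_inner_le_norm _ _) hpow
          _ ≤ |ε| ^ (Fintype.card d - 1) * (V + V) := by
              refine mul_le_mul_of_nonneg_left ?_ hpow
              rw [hω, one_mul]
              exact (norm_sub_le _ _).trans (add_le_add ha hb)
      · refine indicator_apply_le' (fun _ => ?_) (fun _ => zero_le)
        split_ifs
        · exact le_rfl
        · exact zero_le
    · have h0 : (hardSphereDomain (Torus.geometry d) N ε).indicator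
          (fun w => if configEnergy w ≤ E₀ then (c : ℝ≥0∞) else 0)
          (contactInsert ε a b (ω : EuclideanSpace ℝ d) z) = 0 :=
        indicator_apply_eq_zero.2 fun _ => if_neg fun h => hz (hE ▸ h)
      rw [h0, mul_zero]
      exact zero_le
  -- the volume of the shell and the mass of the sphere are finite
  have hvolS : volume S < ⊤ := by
    have hsub : S ⊆ velBall N d (UnitAddTorus d) V :=
      fun z hz => setOf_configEnergy_le_subset_velBall hV0 (show configEnergy z ≤ V ^ 2 / 2 from
        le_trans hz hE₀V)
    refine (measure_mono hsub).trans_lt ?_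
    rw [volume_velBall]
    exact ENNReal.pow_lt_top measure_closedBall_lt_top
  calc ∫⁻ z : Config N d (UnitAddTorus d), ∫⁻ ω : Metric.sphere (0 : EuclideanSpace ℝ d) 1,
        ENNReal.ofReal (ε ^ (Fintype.card d - 1) * ⟪((ω : EuclideanSpace ℝ d)), (z a).2 - (z b).2⟫) *
          (hardSphereDomain (Torus.geometry d) N ε).indicator
            (fun w => if configEnergy w ≤ E₀ then (c : ℝ≥0∞) else 0)
            (contactInsert ε a b (ω : EuclideanSpace ℝ d) z)
        ∂(volume : Measure (EuclideanSpace ℝ d)).toSphere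
      ≤ ∫⁻ z : Config N d (UnitAddTorus d), ∫⁻ _ω : Metric.sphere (0 : EuclideanSpace ℝ d) 1,
          S.indicator (fun _ => W * c) z ∂(volume : Measure (EuclideanSpace ℝ d)).toSphere :=
        lintegral_mono fun z => lintegral_mono fun ω => hpt z ω
    _ = ∫⁻ z : Config N d (UnitAddTorus d), S.indicator (fun _ => W * c) z *
          (volume : Measure (EuclideanSpace ℝ d)).toSphere univ :=
        lintegral_congr fun z => lintegral_const _
    _ = W * c * volume S * (volume : Measure (EuclideanSpace ℝ d)).toSphere univ := by
        rw [lintegral_mul_const _ (measurable_const.indicator hSm), lintegral_indicator_const hSm]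
    _ < ⊤ := by
        refine ENNReal.mul_lt_top (ENNReal.mul_lt_top (ENNReal.mul_lt_top ?_ ?_) hvolS)
          (measure_lt_top _ _)
        · exact ENNReal.ofReal_lt_top
        · exact ENNReal.coe_lt_top

end

end Literature.MathematicalPhysics.KineticTheory
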